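import Literature.Computability.QuantumComplexity.Lemma24Codes
import Literature.Computability.QuantumComplexity.ForrelationMemLists
import Literature.Computability.Complexity.ListFoldBricks
import Literature.Computability.Complexity.FoldCatBricks
import Literature.Computability.Complexity.FPStringBricks
import Literature.Computability.Complexity.PlumbingBricks
import Literature.Computability.Complexity.BranchingFn
import HarnessLib

/-!
# Aaronson–Ambainis Lemma 24 over the sign basis, XII-a: polynomial-time bricks for the gate codes

Part of the discharge of `AaronsonAmbainis2018_lemma24_sign_hard` (plan in `Lemma24Catalysis.lean`).
The instance map of the reduction sends `x` to the code of a sign-basis circuit whose gate list is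
the arithmetic shadow `instNL |x| m x cs` (`Lemma24Codes.lean`) of the input bits, the ancilla count
`m` and the gate codes `cs` of the simulated Clifford+`T` circuit. This file assembles, from the
polynomial-time bricks of `Complexity/` (pair plumbing `BrickAlgebra`, `addFn`, `lenBinF`, `polyFn`,
branching `iteFn`, the list fold `foldFn`, the counted concatenation `foldCat`, the reversal
`ForrMem.revItemsF`), the string functions computing the *pieces* of that code, each with its
membership in `FP` and its value:

* numerals of affine functions of `w = n + m` read off the input record
  `⟨x, ⟨bin n, ⟨1^m, encList codes⟩⟩⟩` (`uwF`, `numF`);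
* **templates** (`templF`): the code of a fixed list of gates whose wires are parameters, given
  `FP` numerals for the parameters — equivariance of the shadow words under renaming
  (`Lemma24Codes`) turns every constant part of the reduction into a template;
* **the transcription transducer** (`itemT`, `transF`): the fold over the gate codes of the simulated
  circuit emitting, per Clifford+`T` gate code, the codes of its sign-basis word with the wire
  numerals shifted by a base offset and the catalyst/real-imaginary numerals spliced in (forward, and
  backwards over the reversed list for the uncomputation half of the copy trick);
* **the preparation pieces** (`prepF`): the counted concatenation over the positions of `x` emitting
  the transcribed `NOT` words at the set bits (forward and backwards).

Arora–Barak 2009, §1.3 (robustness of polynomial time: composition, bounded loops), §6.1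
(descriptions of circuits).

## References

* S. Aaronson, A. Ambainis, *Forrelation*, SIAM J. Comput. 47 (2018), §6, Lemma 24 (p. 26).
* S. Arora, B. Barak, *Computational Complexity: A Modern Approach*, CUP 2009, §1.3, §6.1.
-/

noncomputable section

namespace Literature.Computability.QuantumComplexity

open _root_.Computability Polynomial Complexity Complexity.Brick Complexity.Plumb Complexity.Com

namespace Lemma24

/-! ### Codes of shadows, unfolded -/

/-- Unary numerals are runs of `1`s. [folklore] -/
theorem unaryEncodeNat_eq_ones : ∀ n : ℕ, unaryEncodeNat n = ones n
  | 0 => rfl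
  | n + 1 => by rw [unaryEncodeNat, unaryEncodeNat_eq_ones n]; rfl

/-- The list-of-naturals code: unary length, then the nested pairs of the binary numerals.
[cite: AroraBarak2009, §0.1] -/
theorem listNat_encode (ws : List ℕ) :
    encodingListNatBool.encode ws = boolPair (unaryEncodeNat ws.length) (encList (ws.map encodeNat)) := by
  change boolPair (unaryEncodeNat ws.length) (ws.foldr (fun a acc => boolPair (encodeNat a) acc) []) = _
  congr 1
  induction ws with
  | nil => rfl
  | cons a ws ih => rw [List.foldr_cons, ih, List.map_cons, encList_cons]

/-- The code of a shadow, unfolded. [cite: AroraBarak2009, §6.1] -/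
theorem NGate.code_eq (g : NGate) :
    g.code = false :: boolPair (encodeNat g.op) (boolPair (unaryEncodeNat g.ws.length) (encList (g.ws.map encodeNat))) := by
  rw [NGate.code, listNat_encode]

/-- `encList` of a concatenation. [folklore] -/
theorem encList_append' (l l' : List (List Bool)) : encList (l ++ l') = encList l ++ encList l' :=
  ForrMem.encList_append l l'

/-- `encList` of the codes of a `flatMap`. [folklore] -/
theorem encList_map_flatMap {α : Type} (f : α → List NGate) : ∀ (l : List α),
    encList ((l.flatMap f).map NGate.code) = l.flatMap fun a => encList ((f a).map NGate.code)
  | [] => rfl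
  | a :: l => by
    rw [List.flatMap_cons, List.map_append, encList_append', encList_map_flatMap f l, List.flatMap_cons]

/-- Pointwise-equal functions have equal `flatMap`s over a list. [folklore] -/
theorem flatMap_congr_mem {α β : Type} {f g : α → List β} : ∀ {l : List α}, (∀ a ∈ l, f a = g a) → l.flatMap f = l.flatMap g
  | [], _ => rfl
  | a :: l, h => by rw [List.flatMap_cons, List.flatMap_cons, h a (by simp), flatMap_congr_mem fun b hb => h b (by simp [hb])]

/-- `flatMap` after `map`. [folklore] -/
theorem flatMap_map_comp {α β γ : Type} (g : α → β) (f : β → List γ) : ∀ (l : List α), (l.map g).flatMap f = l.flatMap (f ∘ g)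
  | [] => rfl
  | a :: l => by rw [List.map_cons, List.flatMap_cons, List.flatMap_cons, flatMap_map_comp g f l]; rfl

/-- The reversed range. [folklore] -/
theorem reverse_range_eq_map (n : ℕ) : (List.range n).reverse = (List.range n).map (n - 1 - ·) := by
  apply List.ext_getElem
  · simp
  · intro i h₁ h₂
    simp only [List.length_reverse, List.length_range] at h₁
    simp [List.getElem_reverse]

/-! ### The input record and the numerals of affine functions of `w` -/

/-- `1^{n+m}` from the record `⟨x, ⟨bin n, ⟨1^m, L⟩⟩⟩` (`n = |x|`). [folklore] -/
def uwF : List Bool → List Bool := fun r => onesFn (fstF r) ++ onesFn (nthF 2 r)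

/-- `uwF ∈ FP`. [folklore] -/
theorem uwF_mem_FP : uwF ∈ FP := append_mem_FP (comp_mem_FP onesFn_mem_FP fstF_mem_FP) (comp_mem_FP onesFn_mem_FP (nthF_mem_FP 2))

/-- The length of `uwF`. [folklore] -/
@[simp] theorem length_uwF (r : List Bool) : (uwF r).length = (fstF r).length + (nthF 2 r).length := by
  simp [uwF]

/-- `uwF` on the input record. [folklore] -/
theorem length_uwF_record (x c : List Bool) (m : ℕ) (L : List Bool) :
    (uwF (boolPair x (boolPair c (boolPair (unaryEncodeNat m) L)))).length = x.length + m := by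
  rw [length_uwF, fstF_boolPair]
  simp [nthF, unaryEncodeNat_eq_ones]

/-- `|uwF r| ≤ |r|`. [folklore] -/
theorem length_uwF_le (r : List Bool) : (uwF r).length ≤ r.length := by
  rw [length_uwF]
  have h1 := length_fstF_sndF_le r
  have h2 : (nthF 2 r).length ≤ (sndF r).length := by
    simp only [nthF, Function.comp_apply]
    have := length_fstF_sndF_le (sndF (sndF r)); have := length_fstF_sndF_le (sndF r); omega
  omega

/-- **The numeral of `a·w + b`.** [folklore] -/
def numF (a b : ℕ) : List Bool → List Bool := lenBinF ∘ polyFn (C a * X + C b) ∘ uwF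

/-- Value of `numF`. [folklore] -/
@[simp] theorem numF_apply (a b : ℕ) (r : List Bool) : numF a b r = encodeNat (a * (uwF r).length + b) := by
  simp [numF]

/-- `numF a b ∈ FP`. [folklore] -/
theorem numF_mem_FP (a b : ℕ) : numF a b ∈ FP := comp_mem_FP lenBinF_mem_FP (comp_mem_FP (polyFn_mem_FP _) uwF_mem_FP)

/-- `bin 0 = ε`. [folklore] -/
@[simp] theorem encodeNat_zero' : encodeNat 0 = [] := by decide

/-- Binary numerals are at most as long as unary ones. [folklore] -/
theorem length_encodeNat_le_self : ∀ v : ℕ, (encodeNat v).length ≤ v := by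
  intro v
  induction v using Nat.strong_induction_on with
  | _ v ih =>
    rcases v with _ | v
    · simp [encodeNat_zero']
    · have h := length_encodeNat_succ_le v
      rcases v with _ | v
      · simp [encodeNat] at h ⊢; exact h
      · have := ih (v + 1) (by omega); omega

/-- Size of `numF`. [folklore] -/
theorem length_numF_le (a b : ℕ) (r : List Bool) : (numF a b r).length ≤ a * r.length + b := by
  rw [numF_apply]
  exact (length_encodeNat_le_self _).trans (by have := length_uwF_le r; nlinarith)

/-! ### Templates: the code of a fixed gate list with parameter wires -/

/-- `encList` of the values of a list of string functions. [folklore] -/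
def encListF : List (List Bool → List Bool) → (List Bool → List Bool)
  | [] => fun _ => []
  | Θ :: Θs => fanoutFn Θ (encListF Θs)

/-- Value of `encListF`. [folklore] -/
theorem encListF_apply : ∀ (Θs : List (List Bool → List Bool)) (r : List Bool), encListF Θs r = encList (Θs.map (· r))
  | [], _ => rfl
  | Θ :: Θs, r => by rw [encListF, fanoutFn_apply, encListF_apply Θs r, List.map_cons, encList_cons]

/-- `encListF Θs ∈ FP` for `FP` entries. [folklore] -/
theorem encListF_mem_FP : ∀ {Θs : List (List Bool → List Bool)}, (∀ Θ ∈ Θs, Θ ∈ FP) → encListF Θs ∈ FP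
  | [], _ => const_mem_FP _
  | Θ :: Θs, h => fanoutFn_mem_FP (h Θ (by simp)) (encListF_mem_FP fun Θ' hΘ' => h Θ' (by simp [hΘ']))

/-- Size of `encListF`. [folklore] -/
theorem length_encListF_le {L : ℕ} : ∀ {Θs : List (List Bool → List Bool)} (r : List Bool),
    (∀ Θ ∈ Θs, (Θ r).length ≤ L) → (encListF Θs r).length ≤ Θs.length * (2 * L + 2)
  | [], r, _ => by simp [encListF]
  | Θ :: Θs, r, h => by
    rw [encListF, fanoutFn_apply, length_boolPair, List.length_cons]
    have h1 := h Θ (by simp)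
    have h2 := length_encListF_le (Θs := Θs) r fun Θ' hΘ' => h Θ' (by simp [hΘ'])
    nlinarith

/-- **The code of one gate with opcode `op` and wire numerals `Θs`.** [cite: AroraBarak2009, §6.1] -/
def codeF (op : ℕ) (Θs : List (List Bool → List Bool)) : List Bool → List Bool :=
  List.cons false ∘ fanoutFn (fun _ => encodeNat op) (fanoutFn (fun _ => unaryEncodeNat Θs.length) (encListF Θs))

/-- Value of `codeF`. [folklore] -/
theorem codeF_apply (op : ℕ) (Θs : List (List Bool → List Bool)) (r : List Bool) :
    codeF op Θs r = false :: boolPair (encodeNat op) (boolPair (unaryEncodeNat Θs.length) (encList (Θs.map (· r)))) := by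
  simp [codeF, encListF_apply]

/-- `codeF` computes the code of the shadow with the numerals' values. [cite: AroraBarak2009, §6.1] -/
theorem codeF_eq_code (op : ℕ) {Θs : List (List Bool → List Bool)} {vs : List ℕ} {r : List Bool}
    (h : Θs.map (· r) = vs.map encodeNat) : codeF op Θs r = NGate.code ⟨op, vs⟩ := by
  rw [codeF_apply, NGate.code_eq, h]
  have : Θs.length = vs.length := by simpa using congrArg List.length h
  rw [this]

/-- `codeF op Θs ∈ FP`. [folklore] -/
theorem codeF_mem_FP (op : ℕ) {Θs : List (List Bool → List Bool)} (h : ∀ Θ ∈ Θs, Θ ∈ FP) : codeF op Θs ∈ FP :=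
  comp_mem_FP (cons_mem_FP false) (fanoutFn_mem_FP (const_mem_FP _) (fanoutFn_mem_FP (const_mem_FP _) (encListF_mem_FP h)))

/-- Size of `codeF` for opcodes `≤ 3` and at most three wires. [folklore] -/
theorem length_codeF_le {op : ℕ} (hop : op ≤ 3) {Θs : List (List Bool → List Bool)} (hΘ : Θs.length ≤ 3) {L : ℕ}
    (r : List Bool) (h : ∀ Θ ∈ Θs, (Θ r).length ≤ L) : (codeF op Θs r).length ≤ 6 * L + 21 := by
  rw [codeF, Function.comp_apply, fanoutFn_apply, fanoutFn_apply, List.length_cons, length_boolPair, length_boolPair]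
  have h1 : (encodeNat op).length ≤ 2 := by
    interval_cases op <;> decide
  have h2 : (unaryEncodeNat Θs.length).length ≤ 3 := by rw [unaryEncodeNat_eq_ones]; simpa using hΘ
  have h3 := length_encListF_le r h
  nlinarith

/-- **The template brick**: the code of the gate list `T` whose wires are parameter indices, the
numeral of parameter `i` being computed by `Θ i`. [cite: AroraBarak2009, §6.1] -/
def templF (T : List NGate) (Θ : ℕ → List Bool → List Bool) : List Bool → List Bool :=
  encListF (T.map fun g => codeF g.op (g.ws.map Θ))

/-- **Value of a template**: with numerals `Θ i r = bin (θ i)` it is the code of `T` renamed along `θ`.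
[cite: AroraBarak2009, §6.1] -/
theorem templF_apply {T : List NGate} {Θ : ℕ → List Bool → List Bool} {θ : ℕ → ℕ} {r : List Bool}
    (hΘ : ∀ i, Θ i r = encodeNat (θ i)) : templF T Θ r = encList ((T.map (NGate.ren θ)).map NGate.code) := by
  rw [templF, encListF_apply, List.map_map, List.map_map]
  refine congrArg encList (List.map_congr_left fun g _ => ?_)
  exact codeF_eq_code g.op (by rw [List.map_map, List.map_map]; exact List.map_congr_left fun i _ => hΘ i)

/-- `templF T Θ ∈ FP` for `FP` numerals. [folklore] -/
theorem templF_mem_FP (T : List NGate) {Θ : ℕ → List Bool → List Bool} (hΘ : ∀ i, Θ i ∈ FP) : templF T Θ ∈ FP := by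
  refine encListF_mem_FP fun f hf => ?_
  simp only [List.mem_map] at hf
  obtain ⟨g, -, rfl⟩ := hf
  exact codeF_mem_FP _ fun Θ' hΘ' => by
    simp only [List.mem_map] at hΘ'
    obtain ⟨i, -, rfl⟩ := hΘ'
    exact hΘ i

/-- Well-formed templates: opcodes `≤ 3`, at most three wires. [folklore] -/
def TemplWF (T : List NGate) : Prop := ∀ g ∈ T, g.op ≤ 3 ∧ g.ws.length ≤ 3

/-- Well-formedness of a template is decidable. [folklore] -/
instance (T : List NGate) : Decidable (TemplWF T) := by unfold TemplWF; infer_instance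

/-- **Size of a template**: linear in a bound on the numerals. [folklore] -/
theorem length_templF_le {T : List NGate} (hT : TemplWF T) {Θ : ℕ → List Bool → List Bool} {L : ℕ} (r : List Bool)
    (h : ∀ i, (Θ i r).length ≤ L) : (templF T Θ r).length ≤ T.length * (12 * L + 44) := by
  rw [templF]
  have := length_encListF_le (L := 6 * L + 21) (Θs := T.map fun g => codeF g.op (g.ws.map Θ)) r ?_
  · rw [List.length_map] at this
    calc _ ≤ _ := this
      _ = _ := by ring
  · intro f hf
    simp only [List.mem_map] at hf
    obtain ⟨g, hg, rfl⟩ := hf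
    exact length_codeF_le (hT g hg).1 (by simpa using (hT g hg).2) r fun Θ' hΘ' => by
      simp only [List.mem_map] at hΘ'
      obtain ⟨i, -, rfl⟩ := hΘ'
      exact h i

/-- Renaming distributes over templates made of shadow words: shifting is renaming. [folklore] -/
theorem map_shift_eq_map_ren (d : ℕ) (l : List NGate) : l.map (NGate.shift d) = l.map (NGate.ren (· + d)) := rfl

/-! ### The transcription transducer -/

/-- The code body behind the tag bit of the item (field `1` of `⟨p, a⟩`). [folklore] -/
def tF : List Bool → List Bool := dropFn ∘ fanoutFn (fun _ => [true]) sndF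
/-- The opcode numeral of the item. [folklore] -/
def opF : List Bool → List Bool := fstF ∘ tF
/-- The nested-pair list of the wire numerals of the item. [folklore] -/
def wsF : List Bool → List Bool := sndPow 1 ∘ tF
/-- The base numeral `B` (field `0` of the parameters `p = ⟨B, ⟨CAT, RHO⟩⟩`). [folklore] -/
def pBF : List Bool → List Bool := fstF ∘ fstF
/-- The catalyst numeral. [folklore] -/
def pCF : List Bool → List Bool := nthF 1 ∘ fstF
/-- The real/imaginary-wire numeral. [folklore] -/
def pRF : List Bool → List Bool := sndPow 1 ∘ fstF
/-- The shifted first wire `B + q₀`. [folklore] -/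
def s0F : List Bool → List Bool := addFn ∘ fanoutFn pBF (fstF ∘ wsF)
/-- The shifted second wire `B + q₁`. [folklore] -/
def s1F : List Bool → List Bool := addFn ∘ fanoutFn pBF (nthF 1 ∘ wsF)

/-- The numerals of the transducer: `0 ↦ B + q₀`, `1 ↦ B + q₁`, `2 ↦ CAT`, `3 ↦ RHO`. [folklore] -/
def ΘT (i : ℕ) : List Bool → List Bool :=
  if i = 0 then s0F else if i = 1 then s1F else if i = 2 then pCF else if i = 3 then pRF else fun _ => []

/-- Test of the opcode against a constant. [folklore] -/
def isOpF (c : ℕ) : List Bool → List Bool := eqValFn ∘ fanoutFn opF fun _ => encodeNat c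

/-- The template of the sign-basis word of opcode `op` on parameter wires (`0, 1` the gate's wires,
`2` the catalyst, `3` the real/imaginary wire), forward (`false`) or reversed (`true`); written out.
[cite: AaronsonAmbainis2018, §6 Lemma 24 (p. 26)] -/
def tmOf : Bool → ℕ → List NGate
  | false, 0 => [⟨0, [0]⟩]
  | false, 1 => [⟨2, [0, 3]⟩, ⟨0, [3]⟩, ⟨2, [0, 3]⟩, ⟨0, [3]⟩]
  | false, 2 => [⟨0, [2]⟩, ⟨2, [0, 2]⟩, ⟨0, [2]⟩, ⟨3, [0, 2, 3]⟩, ⟨0, [3]⟩, ⟨3, [0, 2, 3]⟩, ⟨0, [3]⟩]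
  | false, 3 => [⟨0, [1]⟩, ⟨2, [0, 1]⟩, ⟨0, [1]⟩]
  | true, 0 => [⟨0, [0]⟩]
  | true, 1 => [⟨0, [3]⟩, ⟨2, [0, 3]⟩, ⟨0, [3]⟩, ⟨2, [0, 3]⟩]
  | true, 2 => [⟨0, [3]⟩, ⟨3, [0, 2, 3]⟩, ⟨0, [3]⟩, ⟨3, [0, 2, 3]⟩, ⟨0, [2]⟩, ⟨2, [0, 2]⟩, ⟨0, [2]⟩]
  | true, 3 => [⟨0, [1]⟩, ⟨2, [0, 1]⟩, ⟨0, [1]⟩]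
  | _, _ => []

/-- The templates are the sign-basis words on parameter wires. [folklore] -/
theorem tmOf_one (rev : Bool) {op : ℕ} (hop : op ≤ 2) :
    tmOf rev op = (bif rev then (realGatesN' 2 3 ⟨op, [0]⟩).reverse else realGatesN' 2 3 ⟨op, [0]⟩) := by
  interval_cases op <;> cases rev <;> rfl

/-- The `CNOT` template. [folklore] -/
theorem tmOf_three (rev : Bool) :
    tmOf rev 3 = (bif rev then (realGatesN' 2 3 ⟨3, [0, 1]⟩).reverse else realGatesN' 2 3 ⟨3, [0, 1]⟩) := by
  cases rev <;> rfl

/-- **The per-gate transducer**: the codes of the sign-basis word of the item, by cases on its opcode.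
[cite: AaronsonAmbainis2018, §6 Lemma 24 (p. 26)] -/
def itemT (rev : Bool) : List Bool → List Bool :=
  iteFn (isOpF 0) (templF (tmOf rev 0) ΘT) (iteFn (isOpF 1) (templF (tmOf rev 1) ΘT)
    (iteFn (isOpF 2) (templF (tmOf rev 2) ΘT) (iteFn (isOpF 3) (templF (tmOf rev 3) ΘT) fun _ => [])))

/-- `tF ∈ FP`. [folklore] -/
theorem tF_mem_FP : tF ∈ FP := comp_mem_FP dropFn_mem_FP (fanoutFn_mem_FP (const_mem_FP _) sndF_mem_FP)

/-- `s0F ∈ FP`. [folklore] -/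
theorem s0F_mem_FP : s0F ∈ FP :=
  comp_mem_FP addFn_mem_FP (fanoutFn_mem_FP (comp_mem_FP fstF_mem_FP fstF_mem_FP)
    (comp_mem_FP fstF_mem_FP (comp_mem_FP (sndPow_mem_FP 1) tF_mem_FP)))

/-- `s1F ∈ FP`. [folklore] -/
theorem s1F_mem_FP : s1F ∈ FP :=
  comp_mem_FP addFn_mem_FP (fanoutFn_mem_FP (comp_mem_FP fstF_mem_FP fstF_mem_FP)
    (comp_mem_FP (nthF_mem_FP 1) (comp_mem_FP (sndPow_mem_FP 1) tF_mem_FP)))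

/-- The numerals of the transducer are in `FP`. [folklore] -/
theorem ΘT_mem_FP (i : ℕ) : ΘT i ∈ FP := by
  unfold ΘT
  split_ifs
  exacts [s0F_mem_FP, s1F_mem_FP, comp_mem_FP (nthF_mem_FP 1) fstF_mem_FP, comp_mem_FP (sndPow_mem_FP 1) fstF_mem_FP,
    const_mem_FP _]

/-- `isOpF c ∈ FP`. [folklore] -/
theorem isOpF_mem_FP (c : ℕ) : isOpF c ∈ FP :=
  comp_mem_FP eqValFn_mem_FP (fanoutFn_mem_FP (comp_mem_FP fstF_mem_FP tF_mem_FP) (const_mem_FP _))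

/-- `isOpF c` returns one bit. [folklore] -/
theorem oneBit_isOpF (c : ℕ) : OneBit (isOpF c) := fun z => by
  simp only [isOpF, Function.comp_apply, fanoutFn_apply, eqValFn_boolPair]
  exact ⟨_, rfl⟩

/-- **`itemT rev ∈ FP`.** [cite: AroraBarak2009, §1.3] -/
theorem itemT_mem_FP (rev : Bool) : itemT rev ∈ FP :=
  iteFn_mem_FP (isOpF_mem_FP 0) (templF_mem_FP _ ΘT_mem_FP) (iteFn_mem_FP (isOpF_mem_FP 1) (templF_mem_FP _ ΘT_mem_FP)
    (iteFn_mem_FP (isOpF_mem_FP 2) (templF_mem_FP _ ΘT_mem_FP)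
      (iteFn_mem_FP (isOpF_mem_FP 3) (templF_mem_FP _ ΘT_mem_FP) (const_mem_FP _))))

/-- The templates of the transducer are well formed and have at most seven gates. [folklore] -/
theorem templWF_tmOf (rev : Bool) (op : ℕ) : TemplWF (tmOf rev op) ∧ (tmOf rev op).length ≤ 7 := by
  rcases op with _ | _ | _ | _ | op <;> cases rev <;> simp [TemplWF, tmOf]

/-- `sndPow 1` is `sndF ∘ sndF`. [folklore] -/
theorem sndPow_one_apply (v : List Bool) : sndPow 1 v = sndF (sndF v) := rfl

/-- `nthF 1` is `fstF ∘ sndF`. [folklore] -/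
theorem nthF_one_apply (v : List Bool) : nthF 1 v = fstF (sndF v) := rfl

/-- The numerals of the transducer are short: `|ΘT i q| ≤ |q| + 1`. [folklore] -/
theorem length_ΘT_le (i : ℕ) (q : List Bool) : (ΘT i q).length ≤ q.length + 1 := by
  have hp := length_fstF_sndF_le q
  have hpp := length_fstF_sndF_le (fstF q)
  have hppp := length_fstF_sndF_le (sndF (fstF q))
  have ht : (tF q).length ≤ (sndF q).length := by
    simp only [tF, Function.comp_apply, fanoutFn_apply, dropFn_boolPair, List.length_drop, List.length_singleton]
    omega
  have ht1 := length_fstF_sndF_le (tF q)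
  have ht2 := length_fstF_sndF_le (sndF (tF q))
  have ht3 := length_fstF_sndF_le (sndF (sndF (tF q)))
  have ht4 := length_fstF_sndF_le (sndF (sndF (sndF (tF q))))
  unfold ΘT
  split_ifs
  · simp only [s0F, pBF, wsF, Function.comp_apply, fanoutFn_apply, addFn_boolPair, sndPow_one_apply]
    have := length_encodeNat_add_le (fstF (fstF q)) (fstF (sndF (sndF (tF q))))
    omega
  · simp only [s1F, pBF, wsF, Function.comp_apply, fanoutFn_apply, addFn_boolPair, sndPow_one_apply, nthF_one_apply]
    have := length_encodeNat_add_le (fstF (fstF q)) (fstF (sndF (sndF (sndF (tF q)))))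
    omega
  · simp only [pCF, Function.comp_apply, nthF_one_apply]; omega
  · simp only [pRF, Function.comp_apply, sndPow_one_apply]; omega
  · simp

/-- **Size of the per-gate transducer**: `|itemT rev q| ≤ 84 |q| + 406`. [folklore] -/
theorem length_itemT_le (rev : Bool) (q : List Bool) : (itemT rev q).length ≤ 84 * q.length + 406 := by
  have key : ∀ op, (templF (tmOf rev op) ΘT q).length ≤ 84 * q.length + 406 := by
    intro op
    have h := length_templF_le (templWF_tmOf rev op).1 q (fun i => length_ΘT_le i q)
    have hl := (templWF_tmOf rev op).2
    have : (tmOf rev op).length * (12 * (q.length + 1) + 44) ≤ 7 * (12 * (q.length + 1) + 44) := Nat.mul_le_mul_right _ hl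
    omega
  obtain ⟨b0, hb0⟩ := oneBit_isOpF 0 q
  obtain ⟨b1, hb1⟩ := oneBit_isOpF 1 q
  obtain ⟨b2, hb2⟩ := oneBit_isOpF 2 q
  obtain ⟨b3, hb3⟩ := oneBit_isOpF 3 q
  rw [itemT, iteFn_apply hb0]
  split_ifs
  · exact key 0
  rw [iteFn_apply hb1]
  split_ifs
  · exact key 1
  rw [iteFn_apply hb2]
  split_ifs
  · exact key 2
  rw [iteFn_apply hb3]
  split_ifs
  · exact key 3
  · simp

/-- Well-formed shadows of Clifford+`T` gates: `H, S, T` on one wire, `CNOT` on two. [folklore] -/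
def WfC (g : NGate) : Prop := (g.op ≤ 2 ∧ ∃ q, g.ws = [q]) ∨ (g.op = 3 ∧ ∃ c t, g.ws = [c, t])

/-- The parameter record of the transducer. [folklore] -/
def paramRec (b cat rho : ℕ) : List Bool := boolPair (encodeNat b) (boolPair (encodeNat cat) (encodeNat rho))

/-- **The fields of an item record `⟨p, code g⟩`.** [folklore] -/
theorem fields_item (b cat rho : ℕ) (g : NGate) :
    opF (boolPair (paramRec b cat rho) g.code) = encodeNat g.op
      ∧ wsF (boolPair (paramRec b cat rho) g.code) = encList (g.ws.map encodeNat)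
      ∧ pBF (boolPair (paramRec b cat rho) g.code) = encodeNat b
      ∧ pCF (boolPair (paramRec b cat rho) g.code) = encodeNat cat
      ∧ pRF (boolPair (paramRec b cat rho) g.code) = encodeNat rho := by
  have htF : tF (boolPair (paramRec b cat rho) g.code) =
      boolPair (encodeNat g.op) (boolPair (unaryEncodeNat g.ws.length) (encList (g.ws.map encodeNat))) := by
    simp only [tF, Function.comp_apply, fanoutFn_apply, sndF_boolPair, dropFn_boolPair, NGate.code_eq, List.length_singleton,
      List.drop_succ_cons, List.drop_zero]
  refine ⟨?_, ?_, ?_, ?_, ?_⟩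
  · simp only [opF, Function.comp_apply, htF, fstF_boolPair]
  · simp only [wsF, Function.comp_apply, htF, sndPow_one_apply, sndF_boolPair]
  · simp only [pBF, paramRec, Function.comp_apply, fstF_boolPair]
  · simp only [pCF, paramRec, Function.comp_apply, fstF_boolPair, nthF_one_apply, sndF_boolPair]
  · simp only [pRF, paramRec, Function.comp_apply, fstF_boolPair, sndPow_one_apply, sndF_boolPair]

/-- The opcode tests on an item record. [folklore] -/
theorem isOpF_item (c b cat rho : ℕ) (g : NGate) : isOpF c (boolPair (paramRec b cat rho) g.code) = [decide (g.op = c)] := by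
  simp only [isOpF, Function.comp_apply, fanoutFn_apply, (fields_item b cat rho g).1, eqValFn_boolPair, bitsToNat_encodeNat]

/-- The numerals on the record of a one-wire gate. [folklore] -/
theorem ΘT_item_one (b cat rho op q : ℕ) (i : ℕ) :
    ΘT i (boolPair (paramRec b cat rho) (NGate.code ⟨op, [q]⟩)) =
      encodeNat (if i = 0 then q + b else if i = 1 then b else if i = 2 then cat else if i = 3 then rho else 0) := by
  obtain ⟨-, hws, hB, hC, hR⟩ := fields_item b cat rho ⟨op, [q]⟩
  unfold ΘT
  split_ifs
  · simp only [s0F, Function.comp_apply, fanoutFn_apply, hB, hws, List.map_cons, List.map_nil, encList_cons, fstF_boolPair,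
      addFn_boolPair, bitsToNat_encodeNat, Nat.add_comm]
  · simp only [s1F, Function.comp_apply, fanoutFn_apply, hB, hws, List.map_cons, List.map_nil, encList_cons, encList_nil,
      nthF_one_apply, sndF_boolPair, addFn_boolPair, bitsToNat_encodeNat]
    simp [fstF, boolUnpair]
  · exact hC
  · exact hR
  · simp

/-- The numerals on the record of a two-wire gate. [folklore] -/
theorem ΘT_item_two (b cat rho op c t : ℕ) (i : ℕ) :
    ΘT i (boolPair (paramRec b cat rho) (NGate.code ⟨op, [c, t]⟩)) =
      encodeNat (if i = 0 then c + b else if i = 1 then t + b else if i = 2 then cat else if i = 3 then rho else 0) := by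
  obtain ⟨-, hws, hB, hC, hR⟩ := fields_item b cat rho ⟨op, [c, t]⟩
  unfold ΘT
  split_ifs
  · simp only [s0F, Function.comp_apply, fanoutFn_apply, hB, hws, List.map_cons, List.map_nil, encList_cons, fstF_boolPair,
      addFn_boolPair, bitsToNat_encodeNat, Nat.add_comm]
  · simp only [s1F, Function.comp_apply, fanoutFn_apply, hB, hws, List.map_cons, List.map_nil, encList_cons,
      nthF_one_apply, sndF_boolPair, fstF_boolPair, addFn_boolPair, bitsToNat_encodeNat, Nat.add_comm]
  · exact hC
  · exact hR
  · simp

/-- **Value of the per-gate transducer** on the code of a well-formed Clifford+`T` shadow `g` with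
parameters `⟨bin b, ⟨bin cat, bin ρ⟩⟩`: the code of the sign-basis word of `g` shifted by `b`
(reversed if `rev`). [cite: AaronsonAmbainis2018, §6 Lemma 24 (p. 26)] -/
theorem itemT_apply (rev : Bool) (b cat rho : ℕ) {g : NGate} (hg : WfC g) :
    itemT rev (boolPair (paramRec b cat rho) g.code) =
      encList (((bif rev then (realGatesN' cat rho (g.shift b)).reverse else realGatesN' cat rho (g.shift b))).map NGate.code) := by
  have his := fun c => isOpF_item c b cat rho g
  rcases g with ⟨op, ws⟩
  rcases hg with ⟨hle, q, hw⟩ | ⟨h3, c, t, hw⟩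
  · -- one-wire gates
    simp only at hle hw
    subst hw
    have key : templF (tmOf rev op) ΘT (boolPair (paramRec b cat rho) (NGate.code ⟨op, [q]⟩)) =
        encList (((bif rev then (realGatesN' cat rho ((⟨op, [q]⟩ : NGate).shift b)).reverse
          else realGatesN' cat rho ((⟨op, [q]⟩ : NGate).shift b))).map NGate.code) := by
      rw [templF_apply (ΘT_item_one b cat rho op q), tmOf_one rev hle]
      refine congrArg (fun l => encList (List.map NGate.code l)) ?_
      cases rev
      · simp only [cond_false, ren_realGatesN']; rfl
      · simp only [cond_true, List.map_reverse, ren_realGatesN']; rfl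
    simp only at his
    rw [itemT]
    interval_cases op
    · rw [iteFn_apply_true (by rw [his]; rfl), key]
    · rw [iteFn_apply_false (by rw [his]; rfl), iteFn_apply_true (by rw [his]; rfl), key]
    · rw [iteFn_apply_false (by rw [his]; rfl), iteFn_apply_false (by rw [his]; rfl), iteFn_apply_true (by rw [his]; rfl), key]
  · -- CNOT
    simp only at h3 hw
    subst hw; subst h3
    have key : templF (tmOf rev 3) ΘT (boolPair (paramRec b cat rho) (NGate.code ⟨3, [c, t]⟩)) =
        encList (((bif rev then (realGatesN' cat rho ((⟨3, [c, t]⟩ : NGate).shift b)).reverse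
          else realGatesN' cat rho ((⟨3, [c, t]⟩ : NGate).shift b))).map NGate.code) := by
      rw [templF_apply (ΘT_item_two b cat rho 3 c t), tmOf_three rev]
      refine congrArg (fun l => encList (List.map NGate.code l)) ?_
      cases rev
      · simp only [cond_false, ren_realGatesN']; rfl
      · simp only [cond_true, List.map_reverse, ren_realGatesN']; rfl
    simp only at his
    rw [itemT, iteFn_apply_false (by rw [his]; rfl), iteFn_apply_false (by rw [his]; rfl), iteFn_apply_false (by rw [his]; rfl),
      iteFn_apply_true (by rw [his]; rfl), key]

/-! ### The fold over the gate codes -/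

/-- The step of the transcription fold: append the (clipped) output of the per-gate transducer on
`⟨parameters, item⟩` to the accumulator. [cite: AroraBarak2009, §1.3 (bounded loops)] -/
def stepT (rev : Bool) : List Bool → List Bool :=
  appF ∘ fanoutFn (sndPow 1) (clipF 490 (itemT rev ∘ fanoutFn (fstF ∘ fstF) (nthF 1)))

/-- `stepT rev ∈ FP`. [folklore] -/
theorem stepT_mem_FP (rev : Bool) : stepT rev ∈ FP :=
  comp_mem_FP appF_mem_FP (fanoutFn_mem_FP (sndPow_mem_FP 1)
    (clipF_mem_FP 490 (comp_mem_FP (itemT_mem_FP rev) (fanoutFn_mem_FP (comp_mem_FP fstF_mem_FP fstF_mem_FP) (nthF_mem_FP 1)))))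

/-- The step has the growth the fold brick wants. [folklore] -/
theorem foldGrowth_stepT (rev : Bool) : FoldGrowth 490 (stepT rev) := by
  intro v
  simp only [stepT, Function.comp_apply, fanoutFn_apply, appF_boolPair, List.length_append, sndPow_one_apply]
  have := length_clipF_le 490 (itemT rev ∘ fanoutFn (fstF ∘ fstF) (nthF 1)) v
  omega

/-- **The transcription brick**: on `⟨p, encList items⟩`, fold `stepT` over the items from the empty
accumulator. [cite: AroraBarak2009, §1.3 (bounded loops)] -/
def transF (rev : Bool) : List Bool → List Bool := foldFn (stepT rev) fun _ => []

/-- **`transF rev ∈ FP`.** [cite: AroraBarak2009, §1.3, §1.4.1] -/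
theorem transF_mem_FP (rev : Bool) : transF rev ∈ FP := foldFn_mem_FP (stepT_mem_FP rev) (const_mem_FP _) (foldGrowth_stepT rev)

/-- An item of a coded list is shorter than the list. [folklore] -/
theorem length_le_of_mem_items {items : List (List Bool)} {a : List Bool} (h : a ∈ items) : a.length ≤ (encList items).length := by
  induction items with
  | nil => simp at h
  | cons c items ih =>
    rw [encList_cons, length_boolPair]
    rcases List.mem_cons.1 h with rfl | h
    · omega
    · have := ih h; omega

/-- The step on a genuine item is the unclipped transducer. [folklore] -/
theorem stepT_item (rev : Bool) (p L a acc : List Bool) (ha : a.length ≤ L.length) :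
    stepT rev (boolPair (boolPair p L) (boolPair a acc)) = acc ++ itemT rev (boolPair p a) := by
  simp only [stepT, Function.comp_apply, fanoutFn_apply, appF_boolPair, sndPow_one_apply, sndF_boolPair]
  rw [clipF_eq_self]
  · simp only [Function.comp_apply, fanoutFn_apply, fstF_boolPair, nthF_one_apply, sndF_boolPair]
  · simp only [Function.comp_apply, fanoutFn_apply, fstF_boolPair, nthF_one_apply, sndF_boolPair]
    refine (length_itemT_le rev _).trans ?_
    simp only [length_boolPair]
    nlinarith

/-- **Value of the transcription brick** on `⟨⟨bin b, ⟨bin cat, bin ρ⟩⟩, encList (codes of cs)⟩` for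
well-formed Clifford+`T` shadows `cs`: the code of the concatenation of their (shifted) sign-basis words,
each reversed if `rev`. [cite: AaronsonAmbainis2018, §6 Lemma 24 (p. 26)] -/
theorem transF_apply (rev : Bool) (b cat rho : ℕ) {cs : List NGate} (hcs : ∀ g ∈ cs, WfC g) :
    transF rev (boolPair (paramRec b cat rho) (encList (cs.map NGate.code))) =
      encList ((cs.flatMap fun g => bif rev then (realGatesN' cat rho (g.shift b)).reverse else realGatesN' cat rho (g.shift b)).map
        NGate.code) := by
  rw [transF, foldFn_boolPair, decNil_encList]
  -- fold = concatenation of the per-item outputs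
  have key : ∀ (l : List NGate) (acc : List Bool), (∀ g ∈ l, WfC g) → (∀ g ∈ l, g.code.length ≤ (encList (cs.map NGate.code)).length) →
      (l.map NGate.code).foldl (fun acc a => stepT rev (boolPair (boolPair (paramRec b cat rho) (encList (cs.map NGate.code))) (boolPair a acc))) acc =
        acc ++ encList ((l.flatMap fun g => bif rev then (realGatesN' cat rho (g.shift b)).reverse else realGatesN' cat rho (g.shift b)).map
          NGate.code) := by
    intro l
    induction l with
    | nil => intro acc _ _; simp
    | cons g l ih =>
      intro acc hwf hlen
      rw [List.map_cons, List.foldl_cons, stepT_item rev _ _ _ _ (hlen g (by simp)), itemT_apply rev b cat rho (hwf g (by simp)),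
        ih _ (fun g' hg' => hwf g' (by simp [hg'])) (fun g' hg' => hlen g' (by simp [hg'])), List.flatMap_cons, List.map_append,
        encList_append', List.append_assoc]
  rw [key cs [] hcs (fun g hg => length_le_of_mem_items (List.mem_map.2 ⟨g, hg, rfl⟩)), List.nil_append]

/-! ### The preparation pieces -/

/-- The template of the transcribed `NOT` word on parameter wire `0` (`ρ` is parameter `3`), forward or
reversed. [cite: AaronsonAmbainis2018, §6 Lemma 24 (p. 26)] -/
def xTm : Bool → List NGate
  | false => [⟨0, [0]⟩, ⟨2, [0, 3]⟩, ⟨0, [3]⟩, ⟨2, [0, 3]⟩, ⟨0, [3]⟩, ⟨2, [0, 3]⟩, ⟨0, [3]⟩, ⟨2, [0, 3]⟩, ⟨0, [3]⟩, ⟨0, [0]⟩]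
  | true => [⟨0, [0]⟩, ⟨0, [3]⟩, ⟨2, [0, 3]⟩, ⟨0, [3]⟩, ⟨2, [0, 3]⟩, ⟨0, [3]⟩, ⟨2, [0, 3]⟩, ⟨0, [3]⟩, ⟨2, [0, 3]⟩, ⟨0, [0]⟩]

/-- The `NOT`-word templates are the transcribed `NOT` word on parameter wires. [folklore] -/
theorem xTm_eq (rev : Bool) :
    xTm rev = (bif rev then ((xWordN 0).flatMap (realGatesN' 2 3)).reverse else (xWordN 0).flatMap (realGatesN' 2 3)) := by
  cases rev <;> rfl

/-- The unary position read in round `t`: `1ᵗ` forward, `1^{n-1-t}` backwards (`z = ⟨r, 1ᵗ⟩`, `n = |x|`,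
`x = fstF r`). [folklore] -/
def posF : Bool → List Bool → List Bool
  | false => sndF
  | true => dropFn ∘ fanoutFn (List.cons true ∘ sndF) (onesFn ∘ fstF ∘ fstF)

/-- The numerals of a preparation piece: `0 ↦ B + position`, `3 ↦ RHO` (`β`, `ρf` read the record `r`).
[folklore] -/
def ΘP (rev : Bool) (β ρf : List Bool → List Bool) (i : ℕ) : List Bool → List Bool :=
  if i = 0 then addFn ∘ fanoutFn (β ∘ fstF) (lenBinF ∘ posF rev) else if i = 3 then ρf ∘ fstF else fun _ => []

/-- **One preparation piece**: if the bit of `x` at the position of the round is set, the code of the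
transcribed `NOT` word on wire `B + position`, else nothing. [cite: AaronsonAmbainis2018, §6 Lemma 24 (p. 26)] -/
def prepPieceF (rev : Bool) (β ρf : List Bool → List Bool) : List Bool → List Bool :=
  iteFn (bitAtFn ∘ fanoutFn (posF rev) (fstF ∘ fstF)) (templF (xTm rev) (ΘP rev β ρf)) fun _ => []

/-- **The preparation brick**: the counted concatenation of the pieces over the `|x|` positions.
[cite: AroraBarak2009, §1.3 (bounded loops)] -/
def prepF (Q : Polynomial ℕ) (rev : Bool) (β ρf : List Bool → List Bool) : List Bool → List Bool :=
  foldCat Q X (prepPieceF rev β ρf) ∘ fanoutFn id (onesFn ∘ fstF)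

/-- `posF rev ∈ FP`. [folklore] -/
theorem posF_mem_FP (rev : Bool) : posF rev ∈ FP := by
  have h1 : sndF ∈ FP := sndF_mem_FP
  have h2 : dropFn ∘ fanoutFn (List.cons true ∘ sndF) (onesFn ∘ fstF ∘ fstF) ∈ FP :=
    comp_mem_FP dropFn_mem_FP (fanoutFn_mem_FP (comp_mem_FP (cons_mem_FP true) sndF_mem_FP)
      (comp_mem_FP onesFn_mem_FP (comp_mem_FP fstF_mem_FP fstF_mem_FP)))
  cases rev
  · simp only [posF]; exact h1
  · simp only [posF]; exact h2

/-- The numerals of a preparation piece are in `FP`. [folklore] -/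
theorem ΘP_mem_FP (rev : Bool) {β ρf : List Bool → List Bool} (hβ : β ∈ FP) (hρ : ρf ∈ FP) (i : ℕ) : ΘP rev β ρf i ∈ FP := by
  unfold ΘP
  split_ifs
  exacts [comp_mem_FP addFn_mem_FP (fanoutFn_mem_FP (comp_mem_FP hβ fstF_mem_FP) (comp_mem_FP lenBinF_mem_FP (posF_mem_FP rev))),
    comp_mem_FP hρ fstF_mem_FP, const_mem_FP _]

/-- `prepPieceF ∈ FP`. [folklore] -/
theorem prepPieceF_mem_FP (rev : Bool) {β ρf : List Bool → List Bool} (hβ : β ∈ FP) (hρ : ρf ∈ FP) : prepPieceF rev β ρf ∈ FP :=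
  iteFn_mem_FP (comp_mem_FP bitAtFn_mem_FP (fanoutFn_mem_FP (posF_mem_FP rev) (comp_mem_FP fstF_mem_FP fstF_mem_FP)))
    (templF_mem_FP _ (ΘP_mem_FP rev hβ hρ)) (const_mem_FP _)

/-- **`prepF Q rev β ρf ∈ FP`.** [cite: AroraBarak2009, §1.3, §1.4.1] -/
theorem prepF_mem_FP (Q : Polynomial ℕ) (rev : Bool) {β ρf : List Bool → List Bool} (hβ : β ∈ FP) (hρ : ρf ∈ FP) :
    prepF Q rev β ρf ∈ FP :=
  comp_mem_FP (foldCat_mem_FP Q X (prepPieceF_mem_FP rev hβ hρ))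
    (fanoutFn_mem_FP (PolyTimeComputable.id _) (comp_mem_FP onesFn_mem_FP fstF_mem_FP))

/-- The `NOT`-word template is well formed and has ten gates. [folklore] -/
theorem templWF_xTm (rev : Bool) : TemplWF (xTm rev) ∧ (xTm rev).length = 10 := by cases rev <;> simp [TemplWF, xTm]

/-- The position in round `t < n`. [folklore] -/
theorem posF_apply (rev : Bool) (r : List Bool) (t : ℕ) :
    posF rev (boolPair r (ones t)) = ones (bif rev then (fstF r).length - (t + 1) else t) := by
  cases rev
  · simp [posF]
  · simp only [posF, cond_true, Function.comp_apply, fanoutFn_apply, sndF_boolPair, fstF_boolPair, dropFn_boolPair,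
      List.length_cons, onesFn, unaryEncodeNat_eq_ones, ones, List.drop_replicate, List.length_replicate]

/-- **Value of one preparation piece** in round `t < n` on `⟨r, 1ᵗ⟩` with `fstF r = x`, `β r = bin b`,
`ρf r = bin ρ`: at position `l` (`= t` forward, `n - 1 - t` backwards), the code of the transcribed
`NOT` word on wire `b + l` if `x_l = 1`, else `ε`. [cite: AaronsonAmbainis2018, §6 Lemma 24 (p. 26)] -/
theorem prepPieceF_apply (rev : Bool) {β ρf : List Bool → List Bool} {r : List Bool} {b rho : ℕ} (cat : ℕ)
    (hβ : β r = encodeNat b) (hρ : ρf r = encodeNat rho) {t : ℕ} (ht : t < (fstF r).length) :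
    prepPieceF rev β ρf (boolPair r (ones t)) =
      (let l := bif rev then (fstF r).length - (t + 1) else t
       if (fstF r).getD l false = true then
         encList ((bif rev then ((xWordN (b + l)).flatMap (realGatesN' cat rho)).reverse
           else (xWordN (b + l)).flatMap (realGatesN' cat rho)).map NGate.code)
       else []) := by
  have hpos := posF_apply rev r t
  set l := (bif rev then (fstF r).length - (t + 1) else t) with hl
  have hlt : l < (fstF r).length := by cases rev <;> simp [hl] <;> omega
  have hbit : (bitAtFn ∘ fanoutFn (posF rev) (fstF ∘ fstF)) (boolPair r (ones t)) = [(fstF r).getD l false] := by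
    simp only [Function.comp_apply, fanoutFn_apply, hpos, fstF_boolPair]
    rw [bitAtFn_boolPair_of_lt _ _ (by simpa using hlt)]
    simp only [ones, List.length_replicate, List.getD_eq_getElem?_getD, List.getElem?_eq_getElem hlt, Option.getD_some]
  have hθ : ∀ i, ΘP rev β ρf i (boolPair r (ones t)) =
      encodeNat (if i = 0 then b + l else if i = 3 then rho else 0) := by
    intro i
    unfold ΘP
    split_ifs
    · simp only [Function.comp_apply, fanoutFn_apply, fstF_boolPair, hβ, hpos, lenBinF_apply, addFn_boolPair,
        bitsToNat_encodeNat, ones, List.length_replicate]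
    · simp only [Function.comp_apply, fstF_boolPair, hρ]
    · simp
  by_cases hx : (fstF r).getD l false = true
  · rw [prepPieceF, iteFn_apply_true (by rw [hbit, hx]), templF_apply hθ, xTm_eq]
    simp only [hx, if_true]
    refine congrArg (fun l => encList (List.map NGate.code l)) ?_
    cases rev
    · simp only [cond_false, List.map_flatMap, ren_realGatesN']
      rfl
    · simp only [cond_true, List.map_reverse, List.map_flatMap, ren_realGatesN']
      rfl
  · rw [prepPieceF, iteFn_apply_false (by rw [hbit]; simpa using hx)]
    show [] = (if (fstF r).getD l false = true then _ else [])
    rw [if_neg hx]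

/-- `ccat` is the `flatMap` over `range`. [folklore] -/
theorem ccat_eq_flatMap_range (g : ℕ → List Bool) : ∀ k, ccat g k = (List.range k).flatMap g
  | 0 => rfl
  | k + 1 => by rw [ccat_succ, ccat_eq_flatMap_range g k, List.range_succ, List.flatMap_append, List.flatMap_singleton]

/-- **Size of a preparation piece** in a round `t < n`: linear in the record. [folklore] -/
theorem length_prepPieceF_le (rev : Bool) {β ρf : List Bool → List Bool} {a c : ℕ}
    (hβ : ∀ r, (β r).length ≤ a * r.length + c) (hρ : ∀ r, (ρf r).length ≤ a * r.length + c) (r : List Bool) {t : ℕ}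
    (ht : t < (fstF r).length) :
    (prepPieceF rev β ρf (boolPair r (ones t))).length ≤ 10 * (12 * ((a + 2) * r.length + c + 2) + 44) := by
  have hr := length_fstF_sndF_le r
  have hpos : (posF rev (boolPair r (ones t))).length ≤ r.length := by
    rw [posF_apply rev r t]; cases rev <;> simp <;> omega
  have hL : ∀ i, (ΘP rev β ρf i (boolPair r (ones t))).length ≤ (a + 2) * r.length + c + 2 := by
    intro i
    unfold ΘP
    split_ifs
    · simp only [Function.comp_apply, fanoutFn_apply, addFn_boolPair, lenBinF_apply, fstF_boolPair]
      have h1 := length_encodeNat_add_le (β r) (encodeNat (posF rev (boolPair r (ones t))).length)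
      have h2 := hβ r
      have h3 := length_encodeNat_le_self (posF rev (boolPair r (ones t))).length
      nlinarith
    · simp only [Function.comp_apply, fstF_boolPair]
      have h2 := hρ r
      nlinarith
    · simp
  have hlt : (bif rev then (fstF r).length - (t + 1) else t) < (fstF r).length := by cases rev <;> simp <;> omega
  have hbit : (bitAtFn ∘ fanoutFn (posF rev) (fstF ∘ fstF)) (boolPair r (ones t)) =
      [(fstF r).getD (bif rev then (fstF r).length - (t + 1) else t) false] := by
    simp only [Function.comp_apply, fanoutFn_apply, posF_apply rev r t, fstF_boolPair]
    rw [bitAtFn_boolPair_of_lt _ _ (by simpa using hlt)]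
    simp only [ones, List.length_replicate, List.getD_eq_getElem?_getD, List.getElem?_eq_getElem hlt, Option.getD_some]
  rw [prepPieceF, iteFn_apply hbit]
  split_ifs
  · have := length_templF_le (templWF_xTm rev).1 (boolPair r (ones t)) hL
    rw [(templWF_xTm rev).2] at this
    exact this
  · simp

/-- **Value of the preparation brick** on a record `r` with `fstF r = x`, `β r = bin b`, `ρf r = bin ρ`
(enough rounds and room: `|x| ≤ |r|`, pieces within `Q (|r|)`): the code of the transcribed `NOT` words
at the set bits of `x`, on wires `b + l`, in increasing (`rev = false`) or decreasing order of `l` with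
each word reversed (`rev = true`). [cite: AaronsonAmbainis2018, §6 Lemma 24 (p. 26)] -/
theorem prepF_apply {Q : Polynomial ℕ} (rev : Bool) {β ρf : List Bool → List Bool} {r : List Bool} {b rho : ℕ} (cat : ℕ)
    (hβ : β r = encodeNat b) (hρ : ρf r = encodeNat rho)
    (hQ : ∀ t, t < (fstF r).length → (prepPieceF rev β ρf (boolPair r (ones t))).length ≤ Q.eval r.length) :
    prepF Q rev β ρf r =
      encList (((bif rev then
          ((List.range (fstF r).length).reverse.flatMap fun l =>
            if (fstF r).getD l false = true then ((xWordN (b + l)).flatMap (realGatesN' cat rho)).reverse else [])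
        else
          ((List.range (fstF r).length).flatMap fun l =>
            if (fstF r).getD l false = true then (xWordN (b + l)).flatMap (realGatesN' cat rho) else []))).map NGate.code) := by
  have hn : (onesFn (fstF r)).length ≤ X.eval r.length := by
    simp only [length_onesFn, eval_X]; have := length_fstF_sndF_le r; omega
  have hof : onesFn (fstF r) = ones (fstF r).length := by simp [onesFn, unaryEncodeNat_eq_ones]
  rw [prepF, Function.comp_apply, fanoutFn_apply, id, Function.comp_apply, foldCat_apply hn (fun t ht => by
    rw [length_onesFn] at ht; simpa [hof] using hQ t ht)]
  rw [length_onesFn, ccat_eq_flatMap_range]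
  -- both sides are concatenations over the rounds
  cases rev
  · simp only [cond_false]
    rw [encList_map_flatMap]
    refine flatMap_congr_mem fun t ht => ?_
    rw [List.mem_range] at ht
    rw [prepPieceF_apply false cat hβ hρ ht]
    simp only [cond_false]
    split_ifs <;> rfl
  · simp only [cond_true]
    rw [encList_map_flatMap, reverse_range_eq_map, flatMap_map_comp]
    refine flatMap_congr_mem fun t ht => ?_
    rw [List.mem_range] at ht
    rw [prepPieceF_apply true cat hβ hρ ht]
    simp only [cond_true, Function.comp_apply, show (fstF r).length - 1 - t = (fstF r).length - (t + 1) by omega]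
    split_ifs <;> rfl

end Lemma24

end Literature.Computability.QuantumComplexity

end
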